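import Mathlib
import HarnessLib
import Summits.ResolutionOfSingularities.ResolutionOfSingularities.Theorems.WildQuotientsWildQuotientResolutionS1aKillCentreGood
import Summits.ResolutionOfSingularities.ResolutionOfSingularities.Theorems.WildQuotientsWildQuotientResolutionS1aGoodShrink
import Summits.ResolutionOfSingularities.ResolutionOfSingularities.Theorems.WildQuotientsWildQuotientResolutionS1aGameWins

/-!
# S1a — (T2-CONSUMER) A KILL MOVE: bad points of the move lie over bad points missed by the kill charts; `Wins` in one move

[OURS · L1 W4.5c · lead-1 g7; CHAIN v10.3 §4 «(T2)-CONSUMER lemma: an admissible centre all of whose moves have only KILL/EXIT nodes ⇒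
`Wins.of_moves … (Wins.terminal …)`»] — NOT statements of the manuscript; counted 0; AI-level work, weaker than expert review.
Crux stmt-ResolutionOfSingularities-17941, line `s1a-logminvertex` v6, stub `stub_winningStrategy`.

For `G = ⟨g₀⟩` finite of prime order `p`, a `G`-model `M` of finite type over a Noetherian affine base on which `G` acts trivially, a KILL
centre `(𝒦, d)` (`NodeAtlas.IsKillCentre`) and any move `π' : Mʼ → M`:
* **`isGoodAt_of_isIdleChart`** — GOODNESS IS INHERITED OVER IDLE CHARTS: `π'` is an isomorphism there (`IsBlowup.isIso_morphismRestrict`);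
  a good point of `M` has a good `G`-stable basic neighbourhood (`GModel.exists_good_le`, `…S1aGoodShrink`), pulled back to `Mʼ`;
* **`mem_badLocus_of_move`** — `Z(Mʼ) ⊆ π'⁻¹ (Z(M) ∖ ⋃ kill-centre charts)` (`isGoodAt_of_isKillCentreChart`, `…S1aKillCentreGood`);
* **`wins_of_isKillCentre`** — if the kill-centre charts COVER `Z(M)`, every move is terminal and `M` WINS (`GameFrame.Wins.of_moves`).
-/

set_option linter.dupNamespace false

noncomputable section

open CategoryTheory AlgebraicGeometry TopologicalSpace
open Literature.AlgebraicGeometry.Resolution Literature.AlgebraicGeometry.RelativeSpec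
open Summit.ResolutionOfSingularities.ResolutionOfSingularities.Theorems.WildQuotientResolution.S1
open Summit.ResolutionOfSingularities.ResolutionOfSingularities.Theorems.WildQuotientResolution.S1.NodeAtlas
open Summit.ResolutionOfSingularities.ResolutionOfSingularities.Theorems.WildQuotientResolution.S1.BlowupCharts
open Summit.ResolutionOfSingularities.ResolutionOfSingularities.Theorems.WildQuotientResolution.S1.GoodCharts

namespace Summit.ResolutionOfSingularities.ResolutionOfSingularities.Theorems.WildQuotientResolution.S1.GameFrame.GModel

variable {p : ℕ} {X' X₁ : Scheme.{0}} {q : X' ⟶ X₁} {G : Type} [Group G] {ρ : G →* Aut X'} {g₀ : G}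

/-- The preimage of a `G`-stable open under an equivariant map is stable. -/
theorem preimage_stable_of_comm (M M' : GModel p q G ρ g₀) (π' : M'.V ⟶ M.V)
    (hcomm : ∀ g : G, (M'.act.aut g).hom ≫ π' = π' ≫ (M.act.aut g).hom) (O : M.V.Opens)
    (hO : ∀ g : G, (M.act.aut g).hom ⁻¹ᵁ O = O) (g : G) : (M'.act.aut g).hom ⁻¹ᵁ (π' ⁻¹ᵁ O) = π' ⁻¹ᵁ O := by
  rw [← Scheme.Hom.comp_preimage, hcomm g, Scheme.Hom.comp_preimage, hO]

/-- **GOODNESS IS INHERITED OVER IDLE CHARTS**: if `π' : Mʼ → M` is a move along `(𝒦, d)`, `O` an IDLE chart, and `M` is good at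
`π' v'` with `π' v' ∈ O`, then `Mʼ` is good at `v'`. [OURS · L1 W4.5c] -/
theorem isGoodAt_of_isIdleChart [Finite G] (M M' : GModel p q G ρ g₀) (hG : ∀ g : G, g ∈ Subgroup.zpowers g₀)
    (𝒦 : ReesFiltration M.V) (d : ℕ) (π' : M'.V ⟶ M.V) (hbl : IsBlowup π' (𝒦.ideal d)) (hr : M'.r = π' ≫ M.r)
    (hcomm : ∀ g : G, (M'.act.aut g).hom ≫ π' = π' ≫ (M.act.aut g).hom)
    (O : M.act.StableAffineOpens) (hidle : IsIdleChart p M.act g₀ 𝒦 O) {v' : M'.V} (hv' : π'.base v' ∈ O.1)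
    (hgood : M.IsGoodAt (π'.base v')) : M'.IsGoodAt v' := by
  obtain ⟨hnode, htop⟩ := hidle
  -- a good basic neighbourhood inside the idle chart
  obtain ⟨O₂, hvO₂, hO₂O, hO₂, htame₂⟩ := M.exists_good_le hG hgood O.1 O.2.1 hv'
  -- `π'` is an isomorphism over it
  have hdisj : Disjoint (O₂.1 : Set M.V) (𝒦.ideal d).support :=
    (disjoint_support_of_ideal_eq_top hnode.1 (by rw [← ReesFiltration.filtration_ideal]; exact htop d)).mono_left hO₂O
  haveI hiso : IsIso (π' ∣_ O₂.1) := hbl.isIso_morphismRestrict hdisj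
  haveI hP : IsIso (π'.appLE O₂.1 (π' ⁻¹ᵁ O₂.1) le_rfl) := isIso_app_of_isIso_morphismRestrict O₂.1 hiso
  -- the pulled-back chart
  have hstab : ∀ g : G, (M'.act.aut g).hom ⁻¹ᵁ (π' ⁻¹ᵁ O₂.1) = π' ⁻¹ᵁ O₂.1 := preimage_stable_of_comm M M' π' hcomm O₂.1 O₂.2.1
  haveI : IsAffineHom ((π' ⁻¹ᵁ O₂.1).ι ≫ M'.r) := by
    rw [hr, ← Category.assoc, ← morphismRestrict_ι, Category.assoc]
    haveI := O₂.2.2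
    infer_instance
  have hO₂' : IsAffineOpen (π' ⁻¹ᵁ O₂.1) := by
    haveI : IsAffine (O₂.1 : Scheme) := hO₂
    exact IsAffine.of_isIso (π' ∣_ O₂.1)
  let O₂' : M'.act.StableAffineOpens := ⟨π' ⁻¹ᵁ O₂.1, hstab, inferInstance⟩
  obtain ⟨P, hPapply⟩ : ∃ P : Γ(M.V, O₂.1) ≃+* Γ(M'.V, π' ⁻¹ᵁ O₂.1), ∀ s, P s = π'.appLE O₂.1 (π' ⁻¹ᵁ O₂.1) le_rfl s :=
    ⟨(asIso (π'.appLE O₂.1 (π' ⁻¹ᵁ O₂.1) le_rfl)).commRingCatIsoToRingEquiv, fun _ => rfl⟩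
  refine M'.isGoodAt_of_nodeChart_invariants hG v' O₂' hvO₂ hO₂' P.symm (actO M.act O₂ g₀) (fun t => ?_) htame₂
  obtain ⟨s, rfl⟩ := P.surjective t
  have h1 : (M'.act.aut g₀⁻¹).hom.appLE (π' ⁻¹ᵁ O₂.1) (π' ⁻¹ᵁ O₂.1) (hstab g₀⁻¹).ge (P s) = P (actO M.act O₂ g₀ s) := by
    rw [hPapply, hPapply]
    exact appLE_comm_of_le M.act M'.act hcomm O₂.1 O₂.2.1 (π' ⁻¹ᵁ O₂.1) hstab le_rfl g₀⁻¹ s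
  change P.symm ((M'.act.aut g₀⁻¹).hom.appLE O₂'.1 O₂'.1 (O₂'.2.1 g₀⁻¹).ge (P s)) = actO M.act O₂ g₀ (P.symm (P s))
  rw [P.symm_apply_apply]
  exact (congrArg P.symm h1).trans (P.symm_apply_apply _)

/-- **THE BAD LOCUS OF A KILL MOVE**: a bad point of `Mʼ` lies over a bad point of `M` which is in NO kill-centre chart.
[OURS · L1 W4.5c] -/
theorem mem_badLocus_of_move [Finite G] (hp : p.Prime) (hG : ∀ g : G, g ∈ Subgroup.zpowers g₀) (M M' : GModel p q G ρ g₀)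
    (𝒦 : ReesFiltration M.V) (d : ℕ) (hkill : IsKillCentre p M.act g₀ 𝒦 d)
    (π' : M'.V ⟶ M.V) (hbl : IsBlowup π' (𝒦.ideal d)) (hr : M'.r = π' ≫ M.r)
    (hcomm : ∀ g : G, (M'.act.aut g).hom ≫ π' = π' ≫ (M.act.aut g).hom)
    {R₀ : Type} [CommRing R₀] [IsNoetherianRing R₀] (s : M.V ⟶ Spec (.of R₀)) [LocallyOfFiniteType s]
    (hs : ∀ g : G, (M.act.aut g).hom ≫ s = s) {v' : M'.V} (hv' : v' ∈ M'.badLocus) :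
    π'.base v' ∈ M.badLocus ∧ ∀ O : M.act.StableAffineOpens, IsKillCentreChart p M.act g₀ 𝒦 d O → π'.base v' ∉ O.1 := by
  have hkill' : ∀ O : M.act.StableAffineOpens, IsKillCentreChart p M.act g₀ 𝒦 d O → π'.base v' ∉ O.1 := fun O hO hvO =>
    hv' (isGoodAt_of_isKillCentreChart hp hG M M' 𝒦 d hkill.2.1 π' hbl hr hcomm O hO s hs v' hvO)
  refine ⟨fun hgood => ?_, hkill'⟩
  obtain ⟨O, hvO, hO | hO⟩ := hkill.2.2 (π'.base v')
  · exact hkill' O hO hvO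
  · exact hv' (isGoodAt_of_isIdleChart M M' hG 𝒦 d π' hbl hr hcomm O hO hvO hgood)

/-- **`WINS` IN ONE MOVE**: if the kill-centre charts of the kill centre `(𝒦, d)` COVER the bad locus `Z(M)`, then every move of `M`
along `(𝒦, d)` is terminal, and `M` wins. [OURS · L1 W4.5c] -/
theorem wins_of_isKillCentre [Finite G] (hp : p.Prime) (hG : ∀ g : G, g ∈ Subgroup.zpowers g₀) (M : GModel p q G ρ g₀)
    (𝒦 : ReesFiltration M.V) (d : ℕ) (hkill : IsKillCentre p M.act g₀ 𝒦 d)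
    (hcover : ∀ v ∈ M.badLocus, ∃ O : M.act.StableAffineOpens, IsKillCentreChart p M.act g₀ 𝒦 d O ∧ v ∈ O.1)
    {R₀ : Type} [CommRing R₀] [IsNoetherianRing R₀] (s : M.V ⟶ Spec (.of R₀)) [LocallyOfFiniteType s]
    (hs : ∀ g : G, (M.act.aut g).hom ≫ s = s) : Wins p q G ρ g₀ M := by
  refine Wins.of_moves 𝒦 d (isAdmissibleCentre_of_isKillCentre hkill) fun M' hmv => Wins.terminal M' ?_
  obtain ⟨π', hbl, -, hr, hcomm⟩ := hmv
  rw [terminal_iff_badLocus_eq_empty, Set.eq_empty_iff_forall_notMem]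
  intro v' hv'
  obtain ⟨hbad, hno⟩ := mem_badLocus_of_move hp hG M M' 𝒦 d hkill π' hbl hr hcomm s hs hv'
  obtain ⟨O, hO, hvO⟩ := hcover _ hbad
  exact hno O hO hvO

end Summit.ResolutionOfSingularities.ResolutionOfSingularities.Theorems.WildQuotientResolution.S1.GameFrame.GModel

end
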